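import Summits.ResolutionOfSingularities.ResolutionOfSingularities.Theorems.EquisingularLiftEquisingularLiftNatAffineTwoStepPackage
import Summits.ResolutionOfSingularities.ResolutionOfSingularities.Theorems.EquisingularLiftEquisingularLiftNatTwoStepIsoHypPoint
import Summits.ResolutionOfSingularities.ResolutionOfSingularities.Theorems.EquisingularLiftEquisingularLiftNatTwoStepOpen
import HarnessLib

/-!
# [OURS] TWO-STEP THROUGH AN AFFINE HYPERSURFACE CHART: a point of ANY scheme which is hit by an open immersion from `Spec K[y]/(Φ + Ψ)` sending the origin to it
# inherits the two-step property from the second-order data — the form in which the affine level-1 bridge is consumed at a point of `H ⊆ ℙⁿ`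
# (cruxes `Theses.EquisingularLift.EquisingularLiftNat` / `…NatThree` / `EquisingularLift`, stmt-ResolutionOfSingularities-20038 / -20148 / -15660)

[OURS · leafhand-res-equisingularlift-11 g0, 2026-08-31; cell `pub/decomp-res`] AI-produced, weaker than expert review; NOT a statement of any manuscript;
nothing here proves resolution of singularities in positive characteristic.  DEF-FREE helper; no `sorry`; standard axioms; ZERO named hypotheses.

* ★★ `OneStep.twoStepAt_of_affineChart` — `ψ : Spec (K[y]/(Φ + Ψ)) → H` an open immersion with `ψ y₀ = x` (`y₀` the origin, `x` a closed point of `H`), and the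
  second-order data of ✓ `OneStep.twoStepAt_origin` (p833573) ⟹ `x` is a TWO-STEP point of `H`: for every blow-up `τ : Z → H` along `vanishingIdeal {x}` a finite
  `S' ⊆ Z` of closed ONE-STEP points over `x` off which `Z` is regular over `x` — the clause `htwo` of ✓ `PointChain.chain_of_twoStepPoints` / level `1` of the towers.
  Transport: ✓ `PointChain.twoStepAt_of_iso` along `ψ.isoOpensRange`, ✓ `PointChain.twoStepAt_of_open` along the open range.

For `H = V₊(F) ⊆ ℙⁿ_K` at the point over a coordinate vertex `P_c` the chart is `Spec (K[y]/(F(x_c := 1))) ≅ Spec (ChartRing F c) → V₊(F)`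
(✓ `HypersurfaceSpecimen.exists_chartQuotEquiv`, ✓ `chart F c`); what remains there (S) is the point identity `ψ y₀ = x₀`.  Honest label: closes no registered stub.

References: [GortzWedhorn2020, Prop. 13.91, (13.19)]; [StacksProject, Tag 080E]; through the cited tree files.
-/

set_option linter.dupNamespace false -- mandated namespace `Summit.<Summit>.<Problem>` of this single-conjunct summit

noncomputable section

open CategoryTheory CategoryTheory.Limits AlgebraicGeometry TopologicalSpace Topology
open MvPolynomial
open Literature.AlgebraicGeometry.Resolution
open AlgebraicGeometry.Scheme.IdealSheafData

namespace Summit.ResolutionOfSingularities.ResolutionOfSingularities.Cruxes.EquisingularLiftNat.Sections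

namespace OneStep

/-- ★★ **TWO-STEP THROUGH AN AFFINE HYPERSURFACE CHART.**  With the hypotheses of ✓ `twoStepAt_origin` for `f = Φ + Ψ`, an open immersion
`ψ : Spec (K[y]/(f)) → H` with `ψ y₀ = x`, `x` closed in `H`: `x` is a two-step point of `H` (towers' `hDsucc` clause, level `1`). [OURS]
[cite: GortzWedhorn2020, Prop. 13.91] -/
theorem twoStepAt_of_affineChart (K : Type) [Field K] {N : ℕ} (Φ Ψ : MvPolynomial (Fin (N + 1)) K) {μ : ℕ} (hμ : 1 ≤ μ)
    (hΦ : Φ.IsHomogeneous μ) (hΦ0 : Φ ≠ 0)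
    (hΨ : Ψ ∈ Ideal.span (Set.range (X : Fin (N + 1) → MvPolynomial (Fin (N + 1)) K)) ^ (μ + 1))
    (G : Fin (N + 1) → MvPolynomial (Fin (N + 1)) K)
    (hG : ∀ a, aeval (fun j => X a * Function.update (X : Fin (N + 1) → MvPolynomial (Fin (N + 1)) K) a 1 j) (Φ + Ψ) = X a ^ μ * G a)
    (hjac : ∀ a, ∀ P : Ideal (MvPolynomial (Fin (N + 1)) K), P.IsPrime → (X a : MvPolynomial (Fin (N + 1)) K) ∈ P → G a ∈ P →
      (∃ j, pderiv j (G a) ∉ P) ∨ ∀ i, (X i : MvPolynomial (Fin (N + 1)) K) ∈ P)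
    (hsec : ∀ a, G a ∈ Ideal.span (Set.range (X : Fin (N + 1) → MvPolynomial (Fin (N + 1)) K)) →
      ∃ (μ' : ℕ) (Φ' Ψ' : MvPolynomial (Fin (N + 1)) K), 1 ≤ μ' ∧ Φ'.IsHomogeneous μ' ∧ Φ' ≠ 0 ∧
        Ψ' ∈ Ideal.span (Set.range (X : Fin (N + 1) → MvPolynomial (Fin (N + 1)) K)) ^ (μ' + 1) ∧ G a = Φ' + Ψ' ∧
        ∀ b : Fin (N + 1), ∃ G' : MvPolynomial (Fin (N + 1)) K,
          aeval (fun j => X b * Function.update (X : Fin (N + 1) → MvPolynomial (Fin (N + 1)) K) b 1 j) (Φ' + Ψ') = X b ^ μ' * G' ∧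
          ∀ P : Ideal (MvPolynomial (Fin (N + 1)) K), P.IsPrime → (X b : MvPolynomial (Fin (N + 1)) K) ∈ P → G' ∈ P → ∃ j, pderiv j G' ∉ P)
    (y₀ : Spec (CommRingCat.of (MvPolynomial (Fin (N + 1)) K ⧸ Ideal.span {Φ + Ψ})))
    (hy₀ : y₀.asIdeal = Ideal.map (Ideal.Quotient.mk (Ideal.span {Φ + Ψ}))
      (Ideal.span (Set.range (X : Fin (N + 1) → MvPolynomial (Fin (N + 1)) K))))
    {H : Scheme.{0}} (ψ : Spec (CommRingCat.of (MvPolynomial (Fin (N + 1)) K ⧸ Ideal.span {Φ + Ψ})) ⟶ H) [IsOpenImmersion ψ]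
    {x : H} (hψx : ψ y₀ = x) (hx : IsClosed ({x} : Set H)) :
    ∀ (Z : Scheme.{0}) (τ : Z ⟶ H), IsBlowup τ (vanishingIdeal ⟨{x}, hx⟩) →
      ∃ S' : Finset Z, (∀ z : Z, τ z = x → z ∉ S' → IsRegularLocalRing (Z.presheaf.stalk z)) ∧
        ∀ z ∈ S', τ z = x ∧ ∃ hz : IsClosed ({z} : Set Z), ∀ (Z' : Scheme.{0}) (τ' : Z' ⟶ Z),
          IsBlowup τ' (vanishingIdeal ⟨{z}, hz⟩) → ∀ z' : Z', τ' z' = z → IsRegularLocalRing (Z'.presheaf.stalk z') := by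
  have hmax := isMaximal_map_mk_span_range_X K Φ Ψ hμ hΦ hΨ
  have hy₀cl : IsClosed ({y₀} : Set (Spec (CommRingCat.of (MvPolynomial (Fin (N + 1)) K ⧸ Ideal.span {Φ + Ψ})))) :=
    (PrimeSpectrum.isClosed_singleton_iff_isMaximal y₀).mpr (hy₀ ▸ hmax)
  have h0 := twoStepAt_origin K Φ Ψ hμ hΦ hΦ0 hΨ G hG hjac hsec y₀ hy₀ hy₀cl
  -- along `ψ = e.hom ≫ U.ι`
  let U : H.Opens := ψ.opensRange
  let e := ψ.isoOpensRange
  have hψU : ∀ w, U.ι (e.hom w) = ψ w := fun w => by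
    rw [← Scheme.Hom.comp_apply, Scheme.Hom.isoOpensRange_hom_ι]
  have hxU : x ∈ U := ⟨y₀, hψx⟩
  have hu₀ : U.ι (e.hom y₀) = x := (hψU y₀).trans hψx
  have hu₀cl : IsClosed ({e.hom y₀} : Set (U : Scheme.{0})) :=
    PointChain.isClosed_singleton_of_injective U.ι U.ι.isOpenEmbedding.injective (by rw [hu₀]; exact hx)
  have h1 := PointChain.twoStepAt_of_iso e hy₀cl h0 hu₀cl
  exact PointChain.twoStepAt_of_open U hxU hx (e.hom y₀) hu₀ hu₀cl h1

end OneStep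

end Summit.ResolutionOfSingularities.ResolutionOfSingularities.Cruxes.EquisingularLiftNat.Sections

end
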